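import Summits.SmoothPoincare4.SmoothPoincare4.Theorems.CylinderEntropyCylinderRungTwoFluxIdentityCrossings
import HarnessLib

/-!
# The flux identity for connected cross-sections of `S⁴ × ℝ` (stub `stub_fluxIdentity`)

Stub `stub_fluxIdentity` of line `killing-flux` for the crux `CylinderEntropy.CylinderRungTwo`
(stmt-SmoothPoincare4-7631), registered signature, proved without named facts.

## Statement

Let `N = {z ∈ ℝ⁶ | ∑_{i<5} zᵢ² = 1} = S⁴ × ℝ`, `M` a compact connected boundaryless `4`-manifold,
`ι : M → ℝ⁶` a smooth embedding with image in `N` separating the two ends of `N` (no path in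
`N ∖ ι(M)` from height `≤ -R` to height `≥ R`), and `ν : M → ℝ⁶` a continuous unit normal field
along `ι` (`⟪ν, dι⟫ = 0`, `‖ν‖ = 1`) tangent to `N` (`∑_{i<5} νᵢ ιᵢ = 0`). Then the flux of the
vertical Killing field `e₅` through `M` is `± vol(S⁴)`:
`|∫_M ν₅ d(Measure.comap ι μH[4])| = (μH[4] (S⁴ ⊂ ℝ⁵)).toReal` (Mathlib's un-normalised
Hausdorff measure on both sides).

## Proof (parts 1–7 in the sibling files `…FluxIdentity{Gram,Charts,Multiplicity,Normalisation,
PushOff,Sides,Crossings}.lean`, assembled here)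

1. *Area formula with multiplicities for the shadow* `σ = truncL ∘ ι : M → S⁴`: in a chart the
   Gram density of `D(σ ∘ φ⁻¹)` is `|ν₅|` times that of `D(ι ∘ φ⁻¹)` (a `6 × 6` cofactor
   identity), so by the tree's area formula for injective immersions (Federer 3.2.3), summed over
   a countable partition of `{ν₅ ≠ 0}` into injectivity pieces,
   `∫_{±ν₅ > 0} |ν₅| d(ι^*𝓗⁴) = ∫ N_±(p) d𝓗⁴(p)`, `N_±(p) = #{x | σ x = p, ±ν₅ x > 0}`.
2. The shadow of the critical set `{ν₅ = 0}` is `𝓗⁴`-null (the cone over it is Lebesgue-null in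
   `ℝ⁵` by Mathlib's `addHaar_image_eq_zero_of_det_fderivWithin_eq_zero`; polar coordinates),
   and `N_±` are a.e. finite (`𝓗⁴(ι M) < ∞`): for a.e. `p ∈ S⁴` the fibre is finite and regular.
3. *Sides.* Pushing `ι(M)` off itself by `± t ν` and normalising radially back onto `N` misses
   `ι(M)` for `0 < t ≤ t₀` uniformly (compactness + strict differentiability of `ι ∘ φ⁻¹` with
   injective differential orthogonal to `ν`); `M` being connected, all `+ν` push-offs lie in one
   path component of `N ∖ ι(M)` and all `-ν` push-offs in one: two truth values `a₊, a₋` of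
   "joined to the lower end".
4. *Crossing count.* Along the vertical line over a regular `p`, the side is constant between
   crossings, jumps by `d · sign ν₅` (`d = [a₋] - [a₊]`) at each crossing (the point just above
   `ι x` is joined to the `sign(ν₅) ν` push-off through push-offs in the directions
   `(1-s) sign(ν₅) ν + s e₅`), is "lower" far below and, by the SEPARATION hypothesis, "not lower"
   far above: `d · (N₊(p) - N₋(p)) = 1`, so `d = ±1` and `N₊ - N₋ = d` a.e. on `S⁴`.
5. Hence `∫_M ν₅ = ∫ N₊ - ∫ N₋ = ± 𝓗⁴(S⁴)`; Mathlib's `μH[4]` and `μHE[4]` differ by the same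
   constant on `ℝ⁵` and `ℝ⁶`. Connectedness is essential (two slices: flux `0` or `2 vol`).

## References

* H. Federer, *Geometric Measure Theory*, Springer 1969, 3.2.3, 3.2.5 (area formula). [Federer1969]
* M. W. Hirsch, *Differential Topology*, GTM 33, Springer 1976, Ch. 4 §4 (sides of a two-sided
  hypersurface), Ch. 5 §1 (degree as a signed count of preimages). [HirschDT1976]
-/

-- the prescribed namespace `Summit.SmoothPoincare4.SmoothPoincare4.…` repeats `SmoothPoincare4`
set_option linter.dupNamespace false

noncomputable section

open MeasureTheory Set Function Filter Module
open scoped Manifold ContDiff ENNReal Topology RealInnerProductSpace NNReal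

namespace Summit.SmoothPoincare4.SmoothPoincare4.Theorems.CylinderRungTwo.KillingFlux

open Literature.Geometry.Riemannian
open Literature.Geometry.Lorentzian Literature.Geometry.Lorentzian.PseudoRiemannianMetric
open Literature.Geometry.Riemannian.SphericalCylinderEntropy (truncL truncL_apply lipschitz_truncL
  hausdorffMeasure_sphere_four_pos hausdorffMeasure_sphere_four_lt_top)
open Literature.Geometry.Manifold.CylinderSlice (axis castSucc_ne_five)

/-! ## §7 Assembly: the flux identity -/

section Assembly

open Literature.Geometry.GeometricMeasureTheory

variable {M : Type} [TopologicalSpace M] [ChartedSpace (EuclideanSpace ℝ (Fin 4)) M] [IsManifold (𝓡 4) ∞ M]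
  [CompactSpace M] [MeasurableSpace M] [BorelSpace M]

omit [IsManifold (𝓡 4) ∞ M] in
/-- **The flux integral as a difference of two areas**: with `P± = {±ν₅ > 0}`,
`∫_M ν₅ d(ι^*𝓗⁴) = ∫_{P₊} |ν₅| - ∫_{P₋} |ν₅|`, both finite (`|ν₅| ≤ 1`, `𝓗⁴(ι M) < ∞`).
[folklore] -/
theorem integral_nu5_eq_sub {ι ν : M → (EuclideanSpace ℝ (Fin 6))}
    (hι : Manifold.IsSmoothEmbedding (𝓡 4) (𝓡 6) ∞ ι)
    (hνc : Continuous ν) (hνn : (euclideanMetric (EuclideanSpace ℝ (Fin 6))).IsUnitNormal (𝓡 4) ι ν 1) :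
    ∫⁻ x in {x | 0 < ν x 5}, ENNReal.ofReal |ν x 5| ∂(Measure.comap ι (μHE[4] : Measure (EuclideanSpace ℝ (Fin
          6)))) < ⊤ ∧
    ∫⁻ x in {x | ν x 5 < 0}, ENNReal.ofReal |ν x 5| ∂(Measure.comap ι (μHE[4] : Measure (EuclideanSpace ℝ (Fin
          6)))) < ⊤ ∧
    ∫ x, ν x 5 ∂(Measure.comap ι (μHE[4] : Measure (EuclideanSpace ℝ (Fin 6)))) =
      (∫⁻ x in {x | 0 < ν x 5}, ENNReal.ofReal |ν x 5| ∂(Measure.comap ι (μHE[4] : Measure (EuclideanSpace ℝ (Fin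
            6))))).toReal -
      (∫⁻ x in {x | ν x 5 < 0}, ENNReal.ofReal |ν x 5| ∂(Measure.comap ι (μHE[4] : Measure (EuclideanSpace ℝ (Fin
            6))))).toReal := by
  set μE : Measure M := Measure.comap ι (μHE[4] : Measure (EuclideanSpace ℝ (Fin 6))) with hμE
  have hme := measurableEmbedding_of_emb hι
  -- finiteness of the induced area measure
  have hfin : μE univ < ⊤ := by
    rw [hμE, hme.comap_apply, image_univ]
    exact Literature.MeasureTheory.Hausdorff.euclideanHausdorffMeasure_range_lt_top
      (I := 𝓡 4) hι.contMDiff (by simp) (by simp)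
  haveI : IsFiniteMeasure μE := ⟨hfin⟩
  have h5c : Continuous fun x => ν x 5 := (EuclideanSpace.proj (5 : Fin 6)).continuous.comp hνc
  have habs : Continuous fun x => |ν x 5| := continuous_abs.comp h5c
  have hle : ∀ x, |ν x 5| ≤ 1 := fun x => by
    have h := PiLp.norm_apply_le (ν x) (5 : Fin 6)
    rw [norm_nu hνn x, Real.norm_eq_abs] at h
    exact h
  -- finiteness of the two area integrals
  have hbound : ∀ S : Set M, ∫⁻ x in S, ENNReal.ofReal |ν x 5| ∂μE < ⊤ := by
    intro S
    calc ∫⁻ x in S, ENNReal.ofReal |ν x 5| ∂μE ≤ ∫⁻ x in S, 1 ∂μE := by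
          refine lintegral_mono fun x => ?_
          rw [← ENNReal.ofReal_one]
          exact ENNReal.ofReal_le_ofReal (hle x)
      _ = μE S := by rw [lintegral_one, Measure.restrict_apply_univ]
      _ ≤ μE univ := measure_mono (subset_univ _)
      _ < ⊤ := hfin
  refine ⟨hbound _, hbound _, ?_⟩
  -- the decomposition `ν₅ = 1_{P₊} |ν₅| - 1_{P₋} |ν₅|`
  have hPpos : MeasurableSet {x : M | 0 < ν x 5} := (isOpen_lt continuous_const h5c).measurableSet
  have hPneg : MeasurableSet {x : M | ν x 5 < 0} := (isOpen_lt h5c continuous_const).measurableSet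
  have hint : Integrable (fun x => |ν x 5|) μE :=
    (integrable_const (1 : ℝ)).mono' habs.aestronglyMeasurable
      (Eventually.of_forall fun x => by rw [Real.norm_eq_abs, abs_abs]; exact hle x)
  have hdecomp : (fun x => ν x 5) = fun x =>
      {x : M | 0 < ν x 5}.indicator (fun x => |ν x 5|) x - {x : M | ν x 5 < 0}.indicator (fun x => |ν x 5|) x := by
    funext x
    by_cases h1 : 0 < ν x 5
    · rw [indicator_of_mem (show x ∈ {x : M | 0 < ν x 5} from h1),
        indicator_of_notMem (show x ∉ {x : M | ν x 5 < 0} from fun h => lt_asymm h1 h),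
        abs_of_pos h1, sub_zero]
    · by_cases h2 : ν x 5 < 0
      · rw [indicator_of_notMem (show x ∉ {x : M | 0 < ν x 5} from h1),
          indicator_of_mem (show x ∈ {x : M | ν x 5 < 0} from h2), abs_of_neg h2]
        ring
      · have : ν x 5 = 0 := le_antisymm (not_lt.1 h1) (not_lt.1 h2)
        rw [indicator_of_notMem (show x ∉ {x : M | 0 < ν x 5} from h1),
          indicator_of_notMem (show x ∉ {x : M | ν x 5 < 0} from h2), this, sub_zero]
  rw [hdecomp, integral_sub (hint.indicator hPpos) (hint.indicator hPneg), integral_indicator hPpos,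
    integral_indicator hPneg,
    integral_eq_lintegral_of_nonneg_ae (Eventually.of_forall fun x => abs_nonneg _)
      habs.aestronglyMeasurable,
    integral_eq_lintegral_of_nonneg_ae (Eventually.of_forall fun x => abs_nonneg _)
      habs.aestronglyMeasurable]

/-- From an a.e. relation `N₊ = N₋ + 1` on the unit sphere between two integrable multiplicity
functions vanishing off the sphere, `∫ N₊ - ∫ N₋ = 𝓗⁴(S⁴)`. [folklore] -/
theorem toReal_lintegral_sub_of_ae_eq_add_one {N₁ N₂ : (EuclideanSpace ℝ (Fin 5)) → ℝ≥0∞}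
    (h₁ : ∫⁻ p, N₁ p ∂(μHE[4] : Measure (EuclideanSpace ℝ (Fin 5))) < ⊤)
    (hz₁ : ∀ p, p ∉ Metric.sphere (0 : (EuclideanSpace ℝ (Fin 5))) 1 → N₁ p = 0)
    (hz₂ : ∀ p, p ∉ Metric.sphere (0 : (EuclideanSpace ℝ (Fin 5))) 1 → N₂ p = 0)
    (hae : ∀ᵐ p ∂(μHE[4] : Measure (EuclideanSpace ℝ (Fin 5))), p ∈ Metric.sphere (0 : (EuclideanSpace ℝ (Fin 5))) 1
          → N₁ p = N₂ p + 1) :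
    (∫⁻ p, N₁ p ∂(μHE[4] : Measure (EuclideanSpace ℝ (Fin 5)))).toReal - (∫⁻ p, N₂ p ∂(μHE[4] : Measure
          (EuclideanSpace ℝ (Fin 5)))).toReal =
      ((μHE[4] : Measure (EuclideanSpace ℝ (Fin 5))) (Metric.sphere (0 : (EuclideanSpace ℝ (Fin 5)))
            1)).toReal := by
  have hS : MeasurableSet (Metric.sphere (0 : (EuclideanSpace ℝ (Fin 5))) 1) := Metric.isClosed_sphere.measurableSet
  have hind : ∀ {N : (EuclideanSpace ℝ (Fin 5)) → ℝ≥0∞}, (∀ p, p ∉ Metric.sphere (0 : (EuclideanSpace ℝ (Fin 5))) 1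
        → N p = 0) →
      ∫⁻ p, N p ∂(μHE[4] : Measure (EuclideanSpace ℝ (Fin 5))) = ∫⁻ p in Metric.sphere (0 : (EuclideanSpace ℝ (Fin
            5))) 1, N p ∂(μHE[4] : Measure (EuclideanSpace ℝ (Fin 5))) := by
    intro N hN
    rw [← lintegral_indicator hS]
    refine lintegral_congr fun p => ?_
    by_cases hp : p ∈ Metric.sphere (0 : (EuclideanSpace ℝ (Fin 5))) 1
    · rw [indicator_of_mem hp]
    · rw [indicator_of_notMem hp, hN p hp]
  rw [hind hz₁, hind hz₂] at *
  rw [setLIntegral_congr_fun_ae hS hae, lintegral_add_right _ measurable_const, lintegral_one,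
    Measure.restrict_apply_univ] at h₁ ⊢
  rw [ENNReal.toReal_add (lt_of_le_of_lt (self_le_add_right _ _) h₁).ne
    (lt_of_le_of_lt (self_le_add_left _ _) h₁).ne]
  ring

/-- `μH[4] = c⁻¹ • μHE[4]` with the (dimension-`4`) normalising constant `c ≠ 0` of Mathlib's
Euclidean Hausdorff measure, on any space. [folklore] -/
theorem hausdorffMeasure_eq_smul_euclidean {X : Type*} [EMetricSpace X] [MeasurableSpace X] [BorelSpace X] :
    (μH[4] : Measure X) =
      ((Measure.addHaarScalarFactor (volume : Measure (EuclideanSpace ℝ (Fin 4)))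
        (μH[(4 : ℕ)] : Measure (EuclideanSpace ℝ (Fin 4))) : ℝ≥0∞)⁻¹ • (μHE[4] : Measure X)) := by
  rw [Measure.euclideanHausdorffMeasure_def, ENNReal.smul_def, smul_smul,
    ENNReal.inv_mul_cancel (by exact_mod_cast Measure.addHaarScalarFactor_volume_hausdorffMeasure_ne_zero 4)
      ENNReal.coe_ne_top, one_smul]
  rfl

/-- **THE FLUX IDENTITY** (stub `stub_fluxIdentity` of line `killing-flux`, crux
`CylinderEntropy.CylinderRungTwo`, registered signature). For a compact connected boundaryless
`4`-manifold `M`, a smooth embedding `ι : M → N = S⁴ × ℝ ⊂ ℝ⁶` whose image separates the two ends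
of `N`, and any continuous unit normal field `ν` along `ι` tangent to `N`, the flux of the
vertical Killing field `e₅` through `M` is `± vol(S⁴)`:
`|∫_M ν₅ d(ι^* μH⁴)| = μH⁴(S⁴ ⊂ ℝ⁵)`.

Proof (all in this file, fact-free): (1) *area formula with multiplicities* for the shadow
`σ = truncL ∘ ι : M → S⁴` — its Jacobian w.r.t. the induced area is `|ν₅|`
(`det_gram_truncL`), so `∫_{±ν₅>0} |ν₅| d(ι^*𝓗⁴) = ∫_{S⁴} N_±(p) d𝓗⁴` with `N_±(p)` the
number of preimages of `p` with `±ν₅ > 0` (tree area formula for injective immersions, summed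
over a countable partition into injectivity pieces); (2) the shadow of the critical set
`{ν₅ = 0}` is `𝓗⁴`-null (cone trick + Mathlib's degenerate change of variables), and `N_±` are
a.e. finite; (3) *crossing count*: pushing `ι(M)` off itself along `±ν` and normalising back to
`N` defines two sides `a₊, a₋` (uniform push-off lemma by strict differentiability in charts +
path-connectedness of `M`); along the vertical line over a.e. `p ∈ S⁴` the side changes by the
global jump `d = [a₋] - [a₊]` times `sign ν₅` at each crossing and goes from "lower" (far below)
to "not lower" (far above, separation hypothesis), whence `d · (N₊ - N₋) = 1`, `d = ±1`;
(4) hence `∫ ν₅ = ±𝓗⁴(S⁴)`; Mathlib's `μH` and `μHE` differ by the same constant on both sides.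
[folklore] -/
theorem stub_fluxIdentity :
    ∀ (M : Type) [TopologicalSpace M] [T2Space M] [SecondCountableTopology M]
      [ChartedSpace (EuclideanSpace ℝ (Fin 4)) M] [IsManifold (𝓡 4) ∞ M] [CompactSpace M]
      [ConnectedSpace M] [MeasurableSpace M] [BorelSpace M]
      (ι : M → EuclideanSpace ℝ (Fin 6)), Manifold.IsSmoothEmbedding (𝓡 4) (𝓡 6) ∞ ι →
      (∀ x, ∑ i : Fin 5, ι x (Fin.castSucc i) ^ 2 = 1) →
      (∃ R : ℝ, ∀ a b : EuclideanSpace ℝ (Fin 6), ∑ i : Fin 5, a (Fin.castSucc i) ^ 2 = 1 →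
        ∑ i : Fin 5, b (Fin.castSucc i) ^ 2 = 1 → a 5 ≤ -R → R ≤ b 5 →
        ¬ JoinedIn ({z : EuclideanSpace ℝ (Fin 6) | ∑ i : Fin 5, z (Fin.castSucc i) ^ 2 = 1} \
          Set.range ι) a b) →
      ∀ ν : M → EuclideanSpace ℝ (Fin 6), Continuous ν →
        (euclideanMetric (EuclideanSpace ℝ (Fin 6))).IsUnitNormal (𝓡 4) ι ν 1 →
        (∀ x, ∑ i : Fin 5, ν x (Fin.castSucc i) * ι x (Fin.castSucc i) = 0) →
        |∫ x, ν x 5 ∂(Measure.comap ι (μH[4] : Measure (EuclideanSpace ℝ (Fin 6))))| =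
          (μH[4] (Metric.sphere (0 : EuclideanSpace ℝ (Fin 5)) 1)).toReal := by
  intro M _ _ _ _ _ _ _ _ _ ι hι hιN hsepR ν hνc hνn hνt
  obtain ⟨R, hsep⟩ := hsepR
  classical
  -- the multiplicity functions `N±`
  set σ : M → (EuclideanSpace ℝ (Fin 5)) := fun x => truncL (ι x) with hσ
  have h5c : Continuous fun x => ν x 5 := (EuclideanSpace.proj (5 : Fin 6)).continuous.comp hνc
  have hPpos : MeasurableSet {x : M | 0 < ν x 5} := (isOpen_lt continuous_const h5c).measurableSet
  have hPneg : MeasurableSet {x : M | ν x 5 < 0} := (isOpen_lt h5c continuous_const).measurableSet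
  obtain ⟨hmP, hIP⟩ := lintegral_abs_nu5_eq_lintegral_encard hι hιN hνc hνn hνt hPpos fun x hx => ne_of_gt hx
  obtain ⟨hmN, hIN⟩ := lintegral_abs_nu5_eq_lintegral_encard hι hιN hνc hνn hνt hPneg fun x hx => ne_of_lt hx
  obtain ⟨hfinP, hfinN, hint⟩ := integral_nu5_eq_sub hι hνc hνn
  rw [hIP] at hfinP hint
  rw [hIN] at hfinN hint
  have hcrit := hausdorffMeasure_shadow_critical_eq_zero hι hιN hνc hνn hνt
  obtain ⟨d, hd⟩ := exists_degree hι hιN hνc hνn hνt hsep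
  -- the shadow lands in the unit sphere
  have hσS : ∀ x, σ x ∈ Metric.sphere (0 : (EuclideanSpace ℝ (Fin 5))) 1 := fun x => by
    rw [mem_sphere_zero_iff_norm, EuclideanSpace.norm_eq, Real.sqrt_eq_one]
    simpa [hσ, truncL_apply, Real.norm_eq_abs, sq_abs] using hιN x
  have hzero : ∀ (P : Set M) (p : (EuclideanSpace ℝ (Fin 5))), p ∉ Metric.sphere (0 : (EuclideanSpace ℝ (Fin
        5))) 1 →
      ((σ ⁻¹' {p} ∩ P).encard : ℝ≥0∞) = 0 := by
    intro P p hp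
    have : σ ⁻¹' {p} ∩ P = ∅ := by
      ext x
      simp only [mem_inter_iff, mem_preimage, mem_singleton_iff, mem_empty_iff_false, iff_false,
        not_and]
      intro hx
      exact absurd (hx ▸ hσS x) hp
    rw [this, Set.encard_empty, ENat.toENNReal_zero]
  -- a.e. `p ∈ S⁴`: the fibre is finite and regular, and `d (N₊ - N₋) = 1`
  have hae : ∀ᵐ p ∂(μHE[4] : Measure (EuclideanSpace ℝ (Fin 5))), p ∈ Metric.sphere (0 : (EuclideanSpace ℝ (Fin
        5))) 1 →
      ∃ n₁ n₂ : ℕ, ((σ ⁻¹' {p} ∩ {x : M | 0 < ν x 5}).encard : ℝ≥0∞) = n₁ ∧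
        ((σ ⁻¹' {p} ∩ {x : M | ν x 5 < 0}).encard : ℝ≥0∞) = n₂ ∧ d * ((n₁ : ℤ) - n₂) = 1 := by
    filter_upwards [ae_lt_top hmP hfinP.ne, ae_lt_top hmN hfinN.ne,
      measure_eq_zero_iff_ae_notMem.1 hcrit] with p h1 h2 h3 hpS
    have hp : ∑ i : Fin 5, p i ^ 2 = 1 :=
      Literature.Geometry.Manifold.CylinderSlice.sum_sq_eq_one ⟨p, hpS⟩
    have hf₁ : (σ ⁻¹' {p} ∩ {x : M | 0 < ν x 5}).Finite :=
      Set.encard_lt_top_iff.1 (ENat.toENNReal_lt_top.1 h1)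
    have hf₂ : (σ ⁻¹' {p} ∩ {x : M | ν x 5 < 0}).Finite :=
      Set.encard_lt_top_iff.1 (ENat.toENNReal_lt_top.1 h2)
    have hreg' : ∀ x, σ x = p → ν x 5 ≠ 0 := fun x hx h0 => h3 ⟨x, h0, hx⟩
    have hfib : (σ ⁻¹' {p}).Finite := by
      refine (hf₁.union hf₂).subset fun x hx => ?_
      rcases lt_or_gt_of_ne (hreg' x hx) with h | h
      · exact Or.inr ⟨hx, h⟩
      · exact Or.inl ⟨hx, h⟩
    set F := hfib.toFinset with hF
    have hFmem : ∀ x, x ∈ F ↔ truncL (ι x) = p := fun x => by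
      rw [hF, Set.Finite.mem_toFinset]; rfl
    have hreg : ∀ x ∈ F, ν x 5 ≠ 0 := fun x hx => hreg' x ((hFmem x).1 hx)
    have key := hd p hp F hFmem hreg
    -- identify the sets with filters of `F`
    have hset₁ : σ ⁻¹' {p} ∩ {x : M | 0 < ν x 5} = ↑(F.filter fun x => 0 < ν x 5) := by
      ext x; simp [hFmem, hσ]
    have hset₂ : σ ⁻¹' {p} ∩ {x : M | ν x 5 < 0} = ↑(F.filter fun x => ν x 5 < 0) := by
      ext x; simp [hFmem, hσ]
    refine ⟨(F.filter fun x => 0 < ν x 5).card, (F.filter fun x => ν x 5 < 0).card, ?_, ?_, ?_⟩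
    · rw [hset₁, Set.encard_coe_eq_coe_finsetCard]; rfl
    · rw [hset₂, Set.encard_coe_eq_coe_finsetCard]; rfl
    · rw [Finset.sum_ite, Finset.sum_const, Finset.sum_const, nsmul_eq_mul, nsmul_eq_mul, mul_one,
        mul_neg, mul_one] at key
      have hfilt : (F.filter fun x => ¬ 0 < ν x 5) = F.filter fun x => ν x 5 < 0 :=
        Finset.filter_congr fun x hx => ⟨fun h => lt_of_le_of_ne (not_lt.1 h) (hreg x hx),
          fun h => not_lt.2 h.le⟩
      rw [hfilt] at key
      linarith
  -- positivity of `𝓗⁴(S⁴)`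
  have hSpos : 0 < (μHE[4] : Measure (EuclideanSpace ℝ (Fin 5))) (Metric.sphere (0 : (EuclideanSpace ℝ (Fin 5)))
        1) := by
    rw [Measure.euclideanHausdorffMeasure_def, Measure.smul_apply, ENNReal.smul_def, smul_eq_mul]
    exact ENNReal.mul_pos (by exact_mod_cast Measure.addHaarScalarFactor_volume_hausdorffMeasure_ne_zero 4)
      hausdorffMeasure_sphere_four_pos.ne'
  -- the flux w.r.t. `μHE`
  have hmainE : |∫ x, ν x 5 ∂(Measure.comap ι (μHE[4] : Measure (EuclideanSpace ℝ (Fin 6))))| =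
      ((μHE[4] : Measure (EuclideanSpace ℝ (Fin 5))) (Metric.sphere (0 : (EuclideanSpace ℝ (Fin 5)))
            1)).toReal := by
    rw [hint]
    by_cases hd1 : d = 1
    · have hae' : ∀ᵐ p ∂(μHE[4] : Measure (EuclideanSpace ℝ (Fin 5))), p ∈ Metric.sphere (0 : (EuclideanSpace ℝ (Fin
          5))) 1 →
          ((σ ⁻¹' {p} ∩ {x : M | 0 < ν x 5}).encard : ℝ≥0∞) =
            ((σ ⁻¹' {p} ∩ {x : M | ν x 5 < 0}).encard : ℝ≥0∞) + 1 := by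
        filter_upwards [hae] with p hp hpS
        obtain ⟨n₁, n₂, h₁, h₂, h⟩ := hp hpS
        rw [hd1, one_mul] at h
        rw [h₁, h₂, show n₁ = n₂ + 1 by omega]
        push_cast; rfl
      rw [toReal_lintegral_sub_of_ae_eq_add_one hfinP (hzero _) (hzero _) hae']
      exact abs_of_nonneg ENNReal.toReal_nonneg
    by_cases hd2 : d = -1
    · have hae' : ∀ᵐ p ∂(μHE[4] : Measure (EuclideanSpace ℝ (Fin 5))), p ∈ Metric.sphere (0 : (EuclideanSpace ℝ (Fin
          5))) 1 →
          ((σ ⁻¹' {p} ∩ {x : M | ν x 5 < 0}).encard : ℝ≥0∞) =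
            ((σ ⁻¹' {p} ∩ {x : M | 0 < ν x 5}).encard : ℝ≥0∞) + 1 := by
        filter_upwards [hae] with p hp hpS
        obtain ⟨n₁, n₂, h₁, h₂, h⟩ := hp hpS
        rw [hd2, neg_one_mul] at h
        rw [h₁, h₂, show n₂ = n₁ + 1 by omega]
        push_cast; rfl
      rw [← neg_sub, abs_neg, toReal_lintegral_sub_of_ae_eq_add_one hfinN (hzero _) (hzero _) hae']
      exact abs_of_nonneg ENNReal.toReal_nonneg
    · -- impossible: then a.e. point of `S⁴` is bad, but `𝓗⁴(S⁴) > 0`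
      exfalso
      have hbad : ∀ᵐ p ∂(μHE[4] : Measure (EuclideanSpace ℝ (Fin 5))), p ∉ Metric.sphere (0 : (EuclideanSpace ℝ (Fin
            5))) 1 := by
        filter_upwards [hae] with p hp hpS
        obtain ⟨n₁, n₂, -, -, h⟩ := hp hpS
        rcases Int.eq_one_or_neg_one_of_mul_eq_one' h with ⟨h', -⟩ | ⟨h', -⟩
        · exact hd1 h'
        · exact hd2 h'
      exact hSpos.ne' (measure_eq_zero_iff_ae_notMem.2 hbad)
  -- convert `μH ↔ μHE` on both sides
  rw [hausdorffMeasure_eq_smul_euclidean (X := (EuclideanSpace ℝ (Fin 6))), hausdorffMeasure_eq_smul_euclidean (X :=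
        (EuclideanSpace ℝ (Fin 5))),
    Measure.comap_smul, integral_smul_measure, Measure.smul_apply, smul_eq_mul, smul_eq_mul,
    ENNReal.toReal_mul, abs_mul, abs_of_nonneg ENNReal.toReal_nonneg, hmainE]

end Assembly

end Summit.SmoothPoincare4.SmoothPoincare4.Theorems.CylinderRungTwo.KillingFlux
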